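import Literature.Analysis.FluidPDE.FluidComputer.ThresholdLevelTableW
import HarnessLib

/-!
# Kernel run of the level-table checker over the gate-data box, chunks 28 … 31 (bp3 gen 13, layer 4: robustness variant)

HONEST FRAMING: low prior, high value-of-information experiment on Tao's machine paradigm; NOT a
claim that NS blows up.

Four kernel evaluations (`decide +kernel`; no `native_decide`, no extra axioms) of `runSteps`
with the interval gate data `GIw` (all couplings within relative `10⁻³`, `δ ∈ [0, 1.001 δ₀]`),
25 steps each, from `Bw28` to `Bw32`.
-/

namespace Literature.Analysis.FluidPDE.FluidComputer

namespace ThresholdLevelTable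

set_option maxHeartbeats 10000000 in
set_option maxRecDepth 200000 in
/-- Chunk 28 of the data-box table run (steps 700 … 724). [folklore] -/
theorem runW28 : runSteps 60 12 3 GIw RbIt Bw28 chunk28 73345994452495776 = some Bw29 := by
  decide +kernel

set_option maxHeartbeats 10000000 in
set_option maxRecDepth 200000 in
/-- Chunk 29 of the data-box table run (steps 725 … 749). [folklore] -/
theorem runW29 : runSteps 60 12 3 GIw RbIt Bw29 chunk29 87293743852046672 = some Bw30 := by
  decide +kernel

set_option maxHeartbeats 10000000 in
set_option maxRecDepth 200000 in
/-- Chunk 30 of the data-box table run (steps 750 … 774). [folklore] -/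
theorem runW30 : runSteps 60 12 3 GIw RbIt Bw30 chunk30 103893849590411248 = some Bw31 := by
  decide +kernel

set_option maxHeartbeats 10000000 in
set_option maxRecDepth 200000 in
/-- Chunk 31 of the data-box table run (steps 775 … 799). [folklore] -/
theorem runW31 : runSteps 60 12 3 GIw RbIt Bw31 chunk31 123650693697013712 = some Bw32 := by
  decide +kernel

end ThresholdLevelTable

end Literature.Analysis.FluidPDE.FluidComputer
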